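import Mathlib
import Literature.Analysis.FluidPDE.NSCylinderVelocityCompactness
import HarnessLib

/-!
# Weak equicontinuity in time of the velocity pairings, UNIFORMLY IN THE VISCOSITY `|ν| ≤ 1` —
# part 1: the pairing is a primitive of the viscosity-`ν` remainder (support item `EulerZoomLiouville.SereginZoomReduction` = stmt-19834)

Route `EulerZoomLiouville` (NavierStokesRegularity), support item Z = Seregin's Euler-zoom theorem (Seregin 2026
Thm 3.1 = Seregin 2023 Prop 1.2 at `(s,l,κ) = (3,3,2)`, `f(r) = r^ρ`): a compactness argument for the zoomed
sequence `v_k(s,y) = λ_k^{1+ρ} v(t₀ + λ_k^{2+ρ}s, x₀ + λ_k y)`, which solves Navier–Stokes with the VANISHING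
viscosities `ν_k = λ_k^ρ → 0`.  The tree's equicontinuity input of the velocity compactness on a cylinder,
`NSCylinder.exists_fullMeasure_pairing_modulus` (Lin 1998 Thm 2.2 / Bradshaw–Tsai 2019 §4.3), is stated for
`ν = 1`; this file is its `ν`-uniform twin (same proof with `ν` threaded through; for `|ν| ≤ 1` the modulus is
the `ν = 1` one): `setIntegral_deriv_mul_pairing_add_eq_zero_visc` / `exists_ae_pairing_eq_const_add_primitive_visc`
(the pairing `∫_Ω ⟪u(t), η⟫` is a.e. the primitive of `∫_Ω (⟪u, Dη u⟫ + ν⟪u, Δη⟫ + p div η)`),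
`ae_abs_remainder_le_visc` (the remainder bound), `exists_fullMeasure_pairing_modulus_visc` (the modulus
`A|t-s| + B|t-s|^{1/3}` on a full-measure set of times, `A = K₁C + K₂(|Ω| + C)`, `B = 3K₁(|Ω|^{1/2}C_p)^{2/3}`).
WHAT THIS IS NOT: not NS regularity, not the crux; bookkeeping toward the kernel proof of the support item Z
(`--supports` stmt-19834). [folklore]
-/

noncomputable section

set_option linter.dupNamespace false

open MeasureTheory TopologicalSpace Set Function Filter Topology Metric Bornology intervalIntegral
open scoped NNReal ENNReal InnerProductSpace RealInnerProductSpace Laplacian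

namespace Summit.NavierStokesRegularity.NavierStokesRegularity.Theorems.SereginZoomReduction

open Literature.Analysis Literature.Analysis.FluidPDE Literature.Analysis.FunctionSpaces

section Cylinder

variable {u : ℝ → (EuclideanSpace ℝ (Fin 3)) → (EuclideanSpace ℝ (Fin 3))}
  {p : ℝ → (EuclideanSpace ℝ (Fin 3)) → ℝ} {Ω : Opens (EuclideanSpace ℝ (Fin 3))} {a b ν : ℝ}

/-- The viscosity-`ν` remainder `⟪u, Dη u⟫ + ν⟪u, Δη⟫ + p div η` is integrable on the cylinder when
`u` is square integrable and `p` integrable there. [folklore] -/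
theorem integrable_remainder_test_visc (ν : ℝ)
    (hu : Integrable (uncurry u) (volume.restrict (Ioo a b ×ˢ (Ω : Set (EuclideanSpace ℝ (Fin 3))))))
    (hu2 : Integrable (fun z : ℝ × (EuclideanSpace ℝ (Fin 3)) => ‖u z.1 z.2‖ ^ 2)
      (volume.restrict (Ioo a b ×ˢ (Ω : Set (EuclideanSpace ℝ (Fin 3))))))
    (hpi : Integrable (uncurry p) (volume.restrict (Ioo a b ×ˢ (Ω : Set (EuclideanSpace ℝ (Fin 3))))))
    {η : (EuclideanSpace ℝ (Fin 3)) → (EuclideanSpace ℝ (Fin 3))} (hη1 : ContDiff ℝ 2 η) {K₁ K₂ : ℝ}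
    (hK₁ : ∀ x, ‖fderiv ℝ η x‖ ≤ K₁) (hK₂ : ∀ x, ‖Δ η x‖ ≤ K₂) :
    Integrable (fun w : ℝ × (EuclideanSpace ℝ (Fin 3)) =>
        ⟪u w.1 w.2, fderiv ℝ η w.2 (u w.1 w.2)⟫ + ν * ⟪u w.1 w.2, Δ η w.2⟫ +
          p w.1 w.2 * VectorCalculus.divergence η w.2)
      (volume.restrict (Ioo a b ×ˢ (Ω : Set (EuclideanSpace ℝ (Fin 3))))) := by
  have h1 := NSCylinder.integrable_remainder_test hu hu2 hpi hη1 hK₁ hK₂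
  have cL : Continuous (Δ η) := continuous_laplacian hη1
  have i2 : Integrable (fun w : ℝ × (EuclideanSpace ℝ (Fin 3)) => ⟪u w.1 w.2, Δ η w.2⟫)
      (volume.restrict (Ioo a b ×ˢ (Ω : Set (EuclideanSpace ℝ (Fin 3))))) := by
    refine Integrable.mono' (hu.norm.mul_const K₂)
      (hu.1.inner (cL.comp continuous_snd).aestronglyMeasurable) (Eventually.of_forall fun w => ?_)
    exact (norm_inner_le_norm _ _).trans (mul_le_mul_of_nonneg_left (hK₂ w.2) (norm_nonneg _))
  refine (h1.add (i2.const_mul (ν - 1))).congr (Eventually.of_forall fun w => ?_)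
  simp only [Pi.add_apply]
  ring

/-- **Testing the momentum equation (viscosity `ν`, no force) with `χ(t) η(x)` on a product
cylinder.**  For a distributional solution in `W = (a, b) × Ω`, `Ω` bounded, with `u ∈ L²(W)`,
`p ∈ L¹(W)`, a smooth `χ` compactly supported in `(a, b)` and a test field `η` on `Ω`:
`∫_a^b (χ'(t) ∫_Ω ⟪u(t), η⟫ + χ(t) ∫_Ω (⟪u, Dη u⟫ + ν⟪u, Δη⟫ + p div η)(t)) dt = 0`
(the `ν`-threaded copy of `NSCylinder.setIntegral_deriv_mul_pairing_add_eq_zero`). [folklore] -/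
theorem setIntegral_deriv_mul_pairing_add_eq_zero_visc
    (hsol : IsDistributionalNSSolutionOn (timeCylinder Ω a b) ν 0 u p)
    (hbΩ : IsBounded (Ω : Set (EuclideanSpace ℝ (Fin 3))))
    (hu2 : ∫⁻ z in Ioo a b ×ˢ (Ω : Set (EuclideanSpace ℝ (Fin 3))), ‖u z.1 z.2‖ₑ ^ 2 < ∞)
    (hpi : Integrable (uncurry p) (volume.restrict (Ioo a b ×ˢ (Ω : Set (EuclideanSpace ℝ (Fin 3))))))
    {χ : ℝ → ℝ} (hχ : ContDiff ℝ (⊤ : ℕ∞) χ) (hχc : HasCompactSupport χ)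
    (hχI : tsupport χ ⊆ Ioo a b)
    {η : (EuclideanSpace ℝ (Fin 3)) → (EuclideanSpace ℝ (Fin 3))} (hη : FunctionSpaces.IsTestFunctionOn Ω η) :
    ∫ t in Ioo a b,
      ((deriv χ t * ∫ x in (Ω : Set (EuclideanSpace ℝ (Fin 3))), ⟪u t x, η x⟫) +
        χ t * ∫ x in (Ω : Set (EuclideanSpace ℝ (Fin 3))),
          (⟪u t x, fderiv ℝ η x (u t x)⟫ + ν * ⟪u t x, Δ η x⟫ +
            p t x * VectorCalculus.divergence η x)) = 0 := by
  obtain ⟨K₀, K₁, K₂, hK₀, hK₁, hK₂⟩ := exists_bounds_of_isTestFunctionOn hη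
  have hηd : Differentiable ℝ η := hη.contDiff.differentiable (by simp)
  have hη2 : ContDiff ℝ 2 η := hη.contDiff.of_le (by norm_cast)
  have hχd : Differentiable ℝ χ := hχ.differentiable (by simp)
  obtain ⟨Cχ, hCχ⟩ := hχ.continuous.bounded_above_of_compact_support hχc
  obtain ⟨Cχ', hCχ'⟩ := (hχ.continuous_deriv (by simp)).bounded_above_of_compact_support hχc.deriv
  have hm : AEStronglyMeasurable (uncurry u)
      (volume.restrict (Ioo a b ×ˢ (Ω : Set (EuclideanSpace ℝ (Fin 3))))) :=
    hsol.1.aestronglyMeasurable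
  have hu := NSCylinder.integrable_of_lintegral_sq hbΩ hm hu2
  have hu2' := NSCylinder.integrable_norm_sq_of_lintegral_sq hm hu2
  -- the distributional identity for `ψ = χ ⊗ η`
  have hψ : IsSpaceTimeTestOn (timeCylinder Ω a b) (fun s x => χ s • η x) :=
    isSpaceTimeTestOn_prod_smul isOpen_Ioo Ω.isOpen hχ hχc hχI hη
  have key := hsol.2.2.2.2 _ hψ
  -- the two integrable pieces
  set G : ℝ × (EuclideanSpace ℝ (Fin 3)) → ℝ := fun w =>
    ⟪u w.1 w.2, fderiv ℝ η w.2 (u w.1 w.2)⟫ + ν * ⟪u w.1 w.2, Δ η w.2⟫ +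
      p w.1 w.2 * VectorCalculus.divergence η w.2 with hG
  have iU : Integrable (fun w : ℝ × (EuclideanSpace ℝ (Fin 3)) => ⟪u w.1 w.2, η w.2⟫)
      (volume.restrict (Ioo a b ×ˢ (Ω : Set (EuclideanSpace ℝ (Fin 3))))) :=
    NSCylinder.integrable_inner_test hu hη.contDiff.continuous hK₀
  have iG : Integrable G (volume.restrict (Ioo a b ×ˢ (Ω : Set (EuclideanSpace ℝ (Fin 3))))) :=
    integrable_remainder_test_visc ν hu hu2' hpi hη2 hK₁ hK₂
  have iU' : Integrable (fun w : ℝ × (EuclideanSpace ℝ (Fin 3)) => deriv χ w.1 * ⟪u w.1 w.2, η w.2⟫)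
      (volume.restrict (Ioo a b ×ˢ (Ω : Set (EuclideanSpace ℝ (Fin 3))))) :=
    integrable_time_mul iU (hχ.continuous_deriv (by simp)) (C := Cχ')
      fun s => by simpa [Real.norm_eq_abs] using hCχ' s
  have iG' : Integrable (fun w : ℝ × (EuclideanSpace ℝ (Fin 3)) => χ w.1 * G w)
      (volume.restrict (Ioo a b ×ˢ (Ω : Set (EuclideanSpace ℝ (Fin 3))))) :=
    integrable_time_mul iG hχ.continuous (C := Cχ) fun s => by simpa [Real.norm_eq_abs] using hCχ s
  -- rewrite the tested integrand
  have key' : ∫ w in Ioo a b ×ˢ (Ω : Set (EuclideanSpace ℝ (Fin 3))),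
      (deriv χ w.1 * ⟪u w.1 w.2, η w.2⟫ + χ w.1 * G w) = 0 := by
    refine Eq.trans (setIntegral_congr_fun
      (measurableSet_Ioo.prod Ω.isOpen.measurableSet) fun w _ => ?_) key
    rw [hG]
    dsimp only
    rw [timeDeriv_prod_smul hχd, convect_fun_const_smul _ (hηd w.2),
      laplacian_fun_const_smul hη2, divergence_fun_const_smul (hηd w.2)]
    simp only [inner_smul_right, Pi.zero_apply, inner_zero_left, convect]
    ring
  -- Fubini
  rw [FunctionSpaces.AubinLions.volume_restrict_prod] at key' iU iG iU' iG'
  have iS : Integrable (fun w : ℝ × (EuclideanSpace ℝ (Fin 3)) =>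
      deriv χ w.1 * ⟪u w.1 w.2, η w.2⟫ + χ w.1 * G w)
      (((volume : Measure ℝ).restrict (Ioo a b)).prod
        ((volume : Measure (EuclideanSpace ℝ (Fin 3))).restrict
          (Ω : Set (EuclideanSpace ℝ (Fin 3))))) := iU'.add iG'
  rw [integral_prod _ iS] at key'
  have hae : ∀ᵐ t ∂((volume : Measure ℝ).restrict (Ioo a b)),
      (∫ x in (Ω : Set (EuclideanSpace ℝ (Fin 3))), (deriv χ t * ⟪u t x, η x⟫ + χ t * G (t, x))) =
        (deriv χ t * ∫ x in (Ω : Set (EuclideanSpace ℝ (Fin 3))), ⟪u t x, η x⟫) +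
          χ t * ∫ x in (Ω : Set (EuclideanSpace ℝ (Fin 3))),
            (⟪u t x, fderiv ℝ η x (u t x)⟫ + ν * ⟪u t x, Δ η x⟫ +
              p t x * VectorCalculus.divergence η x) := by
    filter_upwards [iU.prod_right_ae, iG.prod_right_ae] with t h1 h2
    rw [integral_add (h1.const_mul _) (h2.const_mul _), MeasureTheory.integral_const_mul,
      MeasureTheory.integral_const_mul]
  rw [← integral_congr_ae hae]
  exact key'

/-- **The pairing is a primitive, a.e.** (viscosity `ν`): for some constant `c` and a.e. `t ∈ (a,b)`,
`∫_Ω ⟪u(t), η⟫ = c + ∫_{(a,t]} ∫_Ω (⟪u, Dη u⟫ + ν⟪u, Δη⟫ + p div η)` (du Bois-Reymond). [folklore] -/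
theorem exists_ae_pairing_eq_const_add_primitive_visc
    (hsol : IsDistributionalNSSolutionOn (timeCylinder Ω a b) ν 0 u p)
    (hbΩ : IsBounded (Ω : Set (EuclideanSpace ℝ (Fin 3))))
    (hu2 : ∫⁻ z in Ioo a b ×ˢ (Ω : Set (EuclideanSpace ℝ (Fin 3))), ‖u z.1 z.2‖ₑ ^ 2 < ∞)
    (hpi : Integrable (uncurry p) (volume.restrict (Ioo a b ×ˢ (Ω : Set (EuclideanSpace ℝ (Fin 3))))))
    {η : (EuclideanSpace ℝ (Fin 3)) → (EuclideanSpace ℝ (Fin 3))} (hη : FunctionSpaces.IsTestFunctionOn Ω η) :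
    ∃ c : ℝ, ∀ᵐ t ∂(volume.restrict (Ioo a b)),
      (∫ x in (Ω : Set (EuclideanSpace ℝ (Fin 3))), ⟪u t x, η x⟫) = c + ∫ s in Ioc a t,
        ∫ x in (Ω : Set (EuclideanSpace ℝ (Fin 3))),
          (⟪u s x, fderiv ℝ η x (u s x)⟫ + ν * ⟪u s x, Δ η x⟫ +
            p s x * VectorCalculus.divergence η x) := by
  obtain ⟨K₀, K₁, K₂, hK₀, hK₁, hK₂⟩ := exists_bounds_of_isTestFunctionOn hη
  have hη2 : ContDiff ℝ 2 η := hη.contDiff.of_le (by norm_cast)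
  have hm : AEStronglyMeasurable (uncurry u)
      (volume.restrict (Ioo a b ×ˢ (Ω : Set (EuclideanSpace ℝ (Fin 3))))) :=
    hsol.1.aestronglyMeasurable
  have hu := NSCylinder.integrable_of_lintegral_sq hbΩ hm hu2
  have hu2' := NSCylinder.integrable_norm_sq_of_lintegral_sq hm hu2
  have iU := NSCylinder.integrable_inner_test hu hη.contDiff.continuous hK₀
  have iG := integrable_remainder_test_visc ν hu hu2' hpi hη2 hK₁ hK₂
  rw [FunctionSpaces.AubinLions.volume_restrict_prod] at iU iG
  refine exists_ae_eq_const_add_primitive iU.integral_prod_left iG.integral_prod_left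
    fun χ hχ hχc hχI => ?_
  exact setIntegral_deriv_mul_pairing_add_eq_zero_visc hsol hbΩ hu2 hpi hχ hχc hχI hη

end Cylinder

end Summit.NavierStokesRegularity.NavierStokesRegularity.Theorems.SereginZoomReduction
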